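import Literature.NumberTheory.GaloisCohomology.Howard2004.DVRSettingPiRefinement
import Literature.NumberTheory.GaloisCohomology.Howard2004.DVRSettingPiRefinementRings
import Literature.NumberTheory.GaloisCohomology.Howard2004.DVRLevelRaisingInjectiveProofs
import Mathlib.LinearAlgebra.Dual.Basis
import Mathlib.Algebra.Module.Torsion.Basic
import Mathlib.NumberTheory.Padics.RingHoms
import HarnessLib

/-!
# Howard 2004, Remark 1.3.1 («H.4 is stable under base change») — the duality datum of H.4 REDUCED to
# the levels `T/π^jT` of the `π`-adic refinement (existence theorems; theorems only)

Topic `NumberTheory/GaloisCohomology/Howard2004` (brick «R4a» of the refinement constructor «REFINE» of seat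
`bsd-line-x10b-p1-w2` g16, over x10b-p1-w6's `PiRefinementDatum` (`PiAdicRefinement.lean`) and w2 g16's
`DVRSetting.piRefinementDatum` (`DVRSettingPiRefinement.lean`, R1); cell `pub/bsd-print-x9`, seat
`bsd-line-x10b-p1-w8` g10).  THEOREMS ONLY: no definition, no named fact, no instance, no notation, no `sorry`
(the datum is delivered in `∃`-form, the pattern of `ResidualDualityDatumProofs.exists_residualDualityDatum`).

WHY (INPUTS row G87 = `Howard2004.thm161_dvrKolyvaginBound` = Howard Thm. 1.6.1; stub `stub_h161` of the μ-crux
stmt-BirchSwinnertonDyer-22642).  `bsd-line-x10b-p1` LEAD g11's ruling (β) on the «LEVEL-GAP» (x10b-p1-w7 g7): Lemma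
1.6.4's induction runs on the FULL tower `T/𝔪^i T`, so a `DVRSetting` (levels `T/𝔪^{e_k}T`, `e` strictly increasing) is
refined to the full one, and H.0–H.5 must be carried to every level `T/π^iT` — Howard's Remark 1.3.1: «the hypotheses
H.0–H.5 are stable under base change in the sense that if `(T, F, 𝓛)` satisfies H.0–H.5 then so does `(T/IT, F, 𝓛)`
(over `R/I`)» (arXiv:1202.6340 p. 7 L125–127).  This file does the module part of H.4 (p. 7 L69–80: «a perfect,
symmetric, `R`-bilinear pairing `T × T → R(1)` with `(s^σ, t^{τστ⁻¹}) = (s,t)^σ`»): the pairing of the host level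
`T^{(k)}` (k = host j), with values in `R_k`, REDUCES to a perfect symmetric equivariant `R/π^j`-bilinear pairing on
`T/π^jT = Level j` with values in `(R/π^j)(1)`.

* §1 (generic: an `R`-linear discrete `Γ_K`-module `T` finite free over a ring `A` with `R ↠ A`, an element `ϖ ∈ R`,
  and a ring map `φ : A → R/ϖ^j` with `φ ∘ (R → A) = (R ↠ R/ϖ^j)` and compatible with the `ℤ_p`-structures)
  **`DualityDatum.exists_modIdeal`**: `∃ Dj : DualityDatum p cd (modIdeal ρ hρ (ϖ^j)) (R ⧸ (ϖ^j))` with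
  `Dj.e [s] [t] = φ (Dk.e s t)` — well defined because `e(ϖ^j T, T) ⊆ ϖ^j A ⊆ ker φ`; SYMMETRIC and EQUIVARIANT from
  `Dk`; PERFECT: injective because `φ ∘ e(s, ·) = 0` forces `e(s, ·) ∈ ϖ^j Hom(T, A)`, i.e. `s ∈ ϖ^jT` (dual basis +
  perfectness of `e`); surjective because an `R/ϖ^j`-linear `T/ϖ^jT → R/ϖ^j` lifts through a basis to
  `Hom_A(T, A) = e♭(T)`; `twistOne = (R/ϖ^j)(1)` with `Γ_K` acting through the `p`-adic cyclotomic character (a discrete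
  module: `p^n ∈ (ϖ^j)`, so the action factors through `χ mod p^n`, `cyclotomicCharacterModPow`).
* §2 (`DVRSetting`) **`DVRSetting.exists_dualityDatum_modIdeal`** (`1 ≤ j ≤ e_k`, any level `k`, ring
  `S.QuotRing j` and `S.toQuotRing hy h` of w2 g16's R2 `DVRSettingPiRefinementRings`) and
  **`DVRSetting.exists_levelDualityDatum`** (the same read on `PiRefinementDatum.levelRep j` / `Level j` / `proj` of the
  refinement datum `S.piRefinementDatum hy` of R1, host level) — freeness from H.0, `R ↠ R_k` and `p ∈ 𝔪 = (π)` from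
  `SatisfiesH`.

NOT HERE: the self-orthogonality of the propagated local conditions for `Dj` (the rest of H.4 = «R4b», sequel file),
H.5(c) on the levels («R4c»), the refined `DVRSetting` itself (w2 g16's R2–R6); `thm161_dvrKolyvaginBound` is NOT proved;
no summit statement is proved; the Birch–Swinnerton-Dyer conjecture is not proved by any of this.
References: [Howard2004HeegnerKolyvagin] §1.3 H.4, Rem. 1.3.1, Def. 1.1.3, §1.6 (arXiv p. 7 L69–80, L125–127; p. 5 L93–99;
p. 12 L29–55); [MazurRubinMemoirs2004] §2.1; [SerreGaloisCohomology1997] I §2.2, II §1 (Tate twists).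
-/

set_option autoImplicit false

noncomputable section

open Function NumberField IsDedekindDomain Field
open scoped NumberField Topology

namespace Literature.NumberTheory.GaloisCohomology.Howard2004

open Literature.NumberTheory.GaloisRepresentations
open Literature.NumberTheory.GaloisRepresentations.DiscreteGaloisModule

/-! ## §1 Generic: an H.4 datum REDUCED modulo `(ϖ^j)` — `T/ϖ^jT` over `R/ϖ^j` -/

namespace DualityDatum

variable {K : Type} [Field K] [NumberField K] {R : Type} [CommRing R]
  {M : Type} [AddCommGroup M] [Module R M] [TopologicalSpace M] [DiscreteTopology M]
  {p : ℕ} [Fact p.Prime] [Algebra ℤ_[p] R]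

omit [NumberField K] in
/-- **`(R/ϖ^j)(1)` is a discrete `Γ_K`-module**: if `p^n ∈ (ϖ^j)` then an element of `Γ_K` with `χ ≡ 1 (mod p^n)` acts
trivially by multiplication by `algebraMap ℤ_[p] (R/ϖ^j) χ`. [cite: SerreGaloisCohomology1997, II §1 (Tate twists)] -/
theorem algebraMap_cyclotomicCharacter_eq_one_of (ϖ : R) (j n : ℕ)
    (hpn : ((p : R)) ^ n ∈ Ideal.span {ϖ ^ j}) (g : absoluteGaloisGroup K)
    (hg : cyclotomicCharacterModPow K p n g = 1) :
    algebraMap ℤ_[p] (R ⧸ Ideal.span {ϖ ^ j}) ((GaloisRep.cyclotomicCharacter K p g : ℤ_[p]ˣ) : ℤ_[p]) = 1 := by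
  set z : ℤ_[p] := ((GaloisRep.cyclotomicCharacter K p g : ℤ_[p]ˣ) : ℤ_[p]) with hz
  have h1 : z - 1 ∈ RingHom.ker (PadicInt.toZModPow n : ℤ_[p] →+* ZMod (p ^ n)) := by
    rw [RingHom.mem_ker, map_sub, map_one, sub_eq_zero, hz, ← cyclotomicCharacterModPow_apply, hg]
  rw [PadicInt.ker_toZModPow, Ideal.mem_span_singleton'] at h1
  obtain ⟨w, hw⟩ := h1
  have hp0 : algebraMap ℤ_[p] (R ⧸ Ideal.span {ϖ ^ j}) ((p : ℤ_[p]) ^ n) = 0 := by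
    rw [map_pow, map_natCast, ← map_natCast (Ideal.Quotient.mk (Ideal.span {ϖ ^ j})) p, ← map_pow,
      Ideal.Quotient.eq_zero_iff_mem]
    exact hpn
  have : z = 1 + w * (p : ℤ_[p]) ^ n := by rw [hw]; ring
  rw [this, map_add, map_one, map_mul, hp0, mul_zero, add_zero]

variable (ρ : DiscreteGaloisModule K M) (hρ : ρ.IsScalarLinear R) (cd : ConjugationDatum K) (ϖ : R) (j : ℕ)
  {A : Type} [CommRing A] [TopologicalSpace A] [DiscreteTopology A] [Algebra ℤ_[p] A] [Algebra R A]
  [Module A M] [IsScalarTower R A M]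

omit [Algebra ℤ_[p] R] in
/-- `e(ϖ^j · T, T) ⊆ ker φ`: the pairing composed with `φ : A → R/ϖ^j` is constant on the fibres of `T ↠ T/ϖ^jT` in
each variable. [cite: Howard2004HeegnerKolyvagin, §1.3 H.4 and Rem. 1.3.1 (arXiv p. 7 L69–80, L125–127)] -/
theorem apply_e_eq_of_mkQ_eq (Dk : DualityDatum p cd ρ A)
    (φ : A →+* R ⧸ Ideal.span {ϖ ^ j}) (hφ : ∀ r : R, φ (algebraMap R A r) = Ideal.Quotient.mk _ r)
    {s s' : M} (h : (Ideal.span {ϖ ^ j} • (⊤ : Submodule R M)).mkQ s = (Ideal.span {ϖ ^ j} • (⊤ : Submodule R M)).mkQ s')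
    (t : M) : φ (Dk.e s t) = φ (Dk.e s' t) := by
  have hmem : s - s' ∈ Ideal.span {ϖ ^ j} • (⊤ : Submodule R M) := by
    rw [← Submodule.ker_mkQ (Ideal.span {ϖ ^ j} • (⊤ : Submodule R M)), LinearMap.mem_ker, map_sub, h, sub_self]
  rw [Submodule.ideal_span_singleton_smul, Submodule.mem_smul_pointwise_iff_exists] at hmem
  obtain ⟨y, -, hy⟩ := hmem
  have hss' : s = s' + ϖ ^ j • y := by rw [hy]; abel
  have h0 : (Ideal.Quotient.mk (Ideal.span {ϖ ^ j})) (ϖ ^ j) = 0 :=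
    Ideal.Quotient.eq_zero_iff_mem.2 (Ideal.mem_span_singleton_self _)
  rw [hss', map_add, LinearMap.add_apply, map_add, ← algebraMap_smul A (ϖ ^ j) y, map_smul,
    LinearMap.smul_apply, smul_eq_mul, map_mul, hφ, h0, zero_mul, add_zero]

/-- **An H.4 datum REDUCES modulo `(ϖ^j)`** (Howard's Remark 1.3.1 for H.4, module part): for an `R`-linear discrete
`Γ_K`-module `T` finite free over a ring `A` with `R ↠ A`, an H.4 datum `Dk` on `T` over `A`, and a ring map
`φ : A → R/ϖ^j` with `φ ∘ (R → A) = (R ↠ R/ϖ^j)` and `φ ∘ (ℤ_p → A) = (ℤ_p → R/ϖ^j)`, there is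
`Dj : DualityDatum p cd (T/ϖ^jT) (R/ϖ^j)` (on the tree's `modIdeal ρ hρ (ϖ^j)`) with `Dj.e [s] [t] = φ (Dk.e s t)` —
symmetric, PERFECT, `Γ_K`-equivariant, `twistOne = (R/ϖ^j)(1)` (`p^n ∈ (ϖ^j)` makes it a discrete module).
[cite: Howard2004HeegnerKolyvagin, §1.3 H.4 and Rem. 1.3.1 (arXiv p. 7 L69–80, L125–127)] [cite: MazurRubinMemoirs2004, §2.1] -/
theorem exists_modIdeal [Module.Free A M] [Module.Finite A M] (Dk : DualityDatum p cd ρ A)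
    (hsurj : Function.Surjective (algebraMap R A))
    (φ : A →+* R ⧸ Ideal.span {ϖ ^ j}) (hφ : ∀ r : R, φ (algebraMap R A r) = Ideal.Quotient.mk _ r)
    (hφp : ∀ z : ℤ_[p], φ (algebraMap ℤ_[p] A z) = algebraMap ℤ_[p] (R ⧸ Ideal.span {ϖ ^ j}) z)
    (n : ℕ) (hpn : ((p : R)) ^ n ∈ Ideal.span {ϖ ^ j}) :
    letI : TopologicalSpace (R ⧸ Ideal.span {ϖ ^ j}) := ⊥
    haveI : DiscreteTopology (R ⧸ Ideal.span {ϖ ^ j}) := ⟨rfl⟩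
    ∃ Dj : DualityDatum p cd (modIdeal ρ hρ (Ideal.span {ϖ ^ j})) (R ⧸ Ideal.span {ϖ ^ j}),
      ∀ s t : M, Dj.e (Submodule.Quotient.mk s) (Submodule.Quotient.mk t) = φ (Dk.e s t) := by
  classical
  letI : TopologicalSpace (R ⧸ Ideal.span {ϖ ^ j}) := ⊥
  haveI : DiscreteTopology (R ⧸ Ideal.span {ϖ ^ j}) := ⟨rfl⟩
  set W : Submodule R M := Ideal.span {ϖ ^ j} • ⊤ with hW
  have hWsurj : Function.Surjective W.mkQ := Submodule.mkQ_surjective W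
  have hmkQ : ∀ s : M, W.mkQ s = Submodule.Quotient.mk s := fun _ => rfl
  have hwd : ∀ s s' t : M, W.mkQ s = W.mkQ s' → φ (Dk.e s t) = φ (Dk.e s' t) :=
    fun s s' t h => apply_e_eq_of_mkQ_eq ρ cd ϖ j Dk φ hφ h t
  have hwd' : ∀ s t t' : M, W.mkQ t = W.mkQ t' → φ (Dk.e s t) = φ (Dk.e s t') := by
    intro s t t' h
    rw [Dk.symm s t, Dk.symm s t', hwd t t' s h]
  -- a set-theoretic section of the quotient map
  let σ : (M ⧸ W) → M := surjInv hWsurj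
  have hσ : ∀ x, W.mkQ (σ x) = x := surjInv_eq hWsurj
  let f : (M ⧸ W) → (M ⧸ W) → R ⧸ Ideal.span {ϖ ^ j} := fun x y => φ (Dk.e (σ x) (σ y))
  have hf : ∀ s t : M, f (W.mkQ s) (W.mkQ t) = φ (Dk.e s t) := by
    intro s t
    change φ (Dk.e (σ (W.mkQ s)) (σ (W.mkQ t))) = _
    rw [hwd (σ (W.mkQ s)) s _ (hσ _), hwd' s (σ (W.mkQ t)) t (hσ _)]
  -- scalars: `(mk r) • [s] = [r • s]` and `e ((algebraMap r) • s) t = algebraMap r * e s t`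
  have hsmul : ∀ (r : R) (s : M), (Ideal.Quotient.mk (Ideal.span {ϖ ^ j}) r) • W.mkQ s = W.mkQ (r • s) :=
    fun _ _ => rfl
  have hesmul : ∀ (r : R) (s t : M), Dk.e (r • s) t = algebraMap R A r * Dk.e s t := by
    intro r s t
    rw [← algebraMap_smul A r s, map_smul, LinearMap.smul_apply, smul_eq_mul]
  have hesmul' : ∀ (r : R) (s t : M), Dk.e s (r • t) = algebraMap R A r * Dk.e s t := by
    intro r s t
    rw [Dk.symm, hesmul, Dk.symm]
  -- the bilinear map
  let ebar : (M ⧸ W) →ₗ[R ⧸ Ideal.span {ϖ ^ j}] (M ⧸ W) →ₗ[R ⧸ Ideal.span {ϖ ^ j}] R ⧸ Ideal.span {ϖ ^ j} :=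
    LinearMap.mk₂ (R ⧸ Ideal.span {ϖ ^ j}) f
    (fun x x' y => by
      obtain ⟨s, rfl⟩ := hWsurj x
      obtain ⟨s', rfl⟩ := hWsurj x'
      obtain ⟨t, rfl⟩ := hWsurj y
      rw [← map_add, hf, hf, hf, map_add, LinearMap.add_apply, map_add])
    (fun a x y => by
      obtain ⟨r, rfl⟩ := Ideal.Quotient.mk_surjective a
      obtain ⟨s, rfl⟩ := hWsurj x
      obtain ⟨t, rfl⟩ := hWsurj y
      rw [hsmul, hf, hf, hesmul, map_mul, hφ, smul_eq_mul])
    (fun x y y' => by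
      obtain ⟨s, rfl⟩ := hWsurj x
      obtain ⟨t, rfl⟩ := hWsurj y
      obtain ⟨t', rfl⟩ := hWsurj y'
      rw [← map_add, hf, hf, hf, map_add, map_add])
    (fun a x y => by
      obtain ⟨r, rfl⟩ := Ideal.Quotient.mk_surjective a
      obtain ⟨s, rfl⟩ := hWsurj x
      obtain ⟨t, rfl⟩ := hWsurj y
      rw [hsmul, hf, hf, hesmul', map_mul, hφ, smul_eq_mul])
  have hebar : ∀ s t : M, ebar (W.mkQ s) (W.mkQ t) = φ (Dk.e s t) := fun s t => hf s t
  -- a basis of `T` and the adjoint isomorphism `e♭ : T ≃ Hom(T, A)`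
  let b := Module.Free.chooseBasis A M
  haveI : Fintype (Module.Free.ChooseBasisIndex A M) := Fintype.ofFinite _
  let eflat : M ≃ₗ[A] (M →ₗ[A] A) := LinearEquiv.ofBijective Dk.e Dk.perfect
  have heflat : ∀ s t, eflat s t = Dk.e s t := fun _ _ => rfl
  -- `ker φ = ϖ^j A`
  have hkerφ : ∀ a : A, φ a = 0 → ∃ a' : A, a = algebraMap R A (ϖ ^ j) * a' := by
    intro a ha
    obtain ⟨r, rfl⟩ := hsurj a
    rw [hφ, Ideal.Quotient.eq_zero_iff_mem, Ideal.mem_span_singleton'] at ha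
    obtain ⟨r', rfl⟩ := ha
    exact ⟨algebraMap R A r', by rw [map_mul, mul_comm]⟩
  -- `φ` is onto
  have hφsurj : Function.Surjective φ := fun a' => by
    obtain ⟨r, rfl⟩ := Ideal.Quotient.mk_surjective a'
    exact ⟨algebraMap R A r, hφ r⟩
  -- the twist `(R/ϖ^j)(1)`
  let χ : absoluteGaloisGroup K → R ⧸ Ideal.span {ϖ ^ j} := fun g =>
    algebraMap ℤ_[p] (R ⧸ Ideal.span {ϖ ^ j}) ((GaloisRep.cyclotomicCharacter K p g : ℤ_[p]ˣ) : ℤ_[p])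
  have hχ_one : χ 1 = 1 := by
    change algebraMap ℤ_[p] (R ⧸ Ideal.span {ϖ ^ j}) ((GaloisRep.cyclotomicCharacter K p 1 : ℤ_[p]ˣ) : ℤ_[p]) = 1
    rw [map_one, Units.val_one, map_one]
  have hχ_mul : ∀ g h, χ (g * h) = χ g * χ h := by
    intro g h
    change algebraMap ℤ_[p] (R ⧸ Ideal.span {ϖ ^ j})
      ((GaloisRep.cyclotomicCharacter K p (g * h) : ℤ_[p]ˣ) : ℤ_[p]) = _
    rw [map_mul, Units.val_mul, map_mul]
  let rep : Representation ℤ (absoluteGaloisGroup K) (R ⧸ Ideal.span {ϖ ^ j}) :=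
    { toFun := fun g => (AddMonoidHom.mulLeft (χ g)).toIntLinearMap
      map_one' := by
        refine LinearMap.ext fun r => ?_
        change χ 1 * r = r
        rw [hχ_one, one_mul]
      map_mul' := fun g h => by
        refine LinearMap.ext fun r => ?_
        change χ (g * h) * r = χ g * (χ h * r)
        rw [hχ_mul, mul_assoc] }
  have hrep : ∀ g r, rep g r = χ g * r := fun _ _ => rfl
  let tw : DiscreteGaloisModule K (R ⧸ Ideal.span {ϖ ^ j}) := ContinuousRep.ofStabilizerMemNhdsOne rep fun r => by
    have h1 : {g : absoluteGaloisGroup K | cyclotomicCharacterModPow K p n g = 1} ∈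
        𝓝 (1 : absoluteGaloisGroup K) :=
      ((isOpen_discrete ({1} : Set (ZMod (p ^ n)))).preimage
        (continuous_cyclotomicCharacterModPow K p n)).mem_nhds (by simp)
    filter_upwards [h1] with g hg
    change rep g r = r
    rw [hrep, show χ g = 1 from algebraMap_cyclotomicCharacter_eq_one_of ϖ j n hpn g hg, one_mul]
  have htw : ∀ (g : absoluteGaloisGroup K) (r : R ⧸ Ideal.span {ϖ ^ j}), tw g r = χ g * r := fun _ _ => rfl
  refine ⟨{ e := ebar
            symm := ?_
            perfect := ⟨?_, ?_⟩
            equivariant := ?_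
            twistOne := tw
            twistOne_apply := htw }, hebar⟩
  · -- symmetric
    intro x y
    obtain ⟨s, rfl⟩ := hWsurj x
    obtain ⟨t, rfl⟩ := hWsurj y
    rw [hebar, hebar, Dk.symm]
  · -- injective
    intro x x' hxx'
    rw [← sub_eq_zero]
    obtain ⟨s, hs⟩ := hWsurj (x - x')
    rw [← hs]
    have hzero : ∀ t, φ (Dk.e s t) = 0 := fun t => by
      rw [← hebar, hs, map_sub, LinearMap.sub_apply, hxx', sub_self]
    choose c hc using fun t => hkerφ _ (hzero t)
    have hsm : s ∈ W := by
      have hrepr : s = ∑ i, (eflat s) (b i) • eflat.symm (b.coord i) := by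
        apply eflat.injective
        rw [map_sum]
        simp_rw [map_smul, LinearEquiv.apply_symm_apply]
        exact (Module.Basis.sum_dual_apply_smul_coord b (eflat s)).symm
      rw [hrepr]
      refine Submodule.sum_mem _ fun i _ => ?_
      rw [heflat, hc (b i), mul_smul, algebraMap_smul]
      exact Submodule.smul_mem_smul (Ideal.mem_span_singleton_self _) Submodule.mem_top
    rw [Submodule.mkQ_apply, Submodule.Quotient.mk_eq_zero]
    exact hsm
  · -- surjective
    intro G
    choose a ha using fun t : M => hφsurj (G (W.mkQ t))
    let g : M →ₗ[A] A := ∑ i, a (b i) • b.coord i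
    refine ⟨W.mkQ (eflat.symm g), LinearMap.ext fun y => ?_⟩
    obtain ⟨t, rfl⟩ := hWsurj y
    rw [hebar, ← heflat, LinearEquiv.apply_symm_apply]
    conv_rhs => rw [← b.sum_repr t]
    rw [map_sum, map_sum]
    change φ ((∑ i, a (b i) • b.coord i) t) = _
    rw [LinearMap.sum_apply, map_sum]
    refine Finset.sum_congr rfl fun i _ => ?_
    obtain ⟨r, hr⟩ := hsurj (b.repr t i)
    rw [LinearMap.smul_apply, Module.Basis.coord_apply, smul_eq_mul, map_mul, ha (b i), ← hr, hφ,
      algebraMap_smul, ← hsmul, map_smul, smul_eq_mul, mul_comm]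
  · -- equivariant
    intro g x y
    obtain ⟨s, rfl⟩ := hWsurj x
    obtain ⟨t, rfl⟩ := hWsurj y
    change ebar (W.mkQ (ρ g s)) (W.mkQ (ρ (cd.conj g) t)) = _ * ebar (W.mkQ s) (W.mkQ t)
    rw [hebar, hebar, Dk.equivariant, map_mul, hφp]

end DualityDatum

/-! ## §2 On a `DVRSetting` with H.0–H.5: the duality datum of every `T^{(k)}/π^jT^{(k)}`, `1 ≤ j ≤ e_k` -/

namespace DVRSetting

variable {p : ℕ} [Fact p.Prime] {K : Type} [Field K] [NumberField K]
  {R : Type} [CommRing R] [IsDomain R] [IsDiscreteValuationRing R] [Algebra ℤ_[p] R]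
  {N : ℕ → Type} [∀ k, AddCommGroup (N k)] [∀ k, TopologicalSpace (N k)]
  [∀ k, DiscreteTopology (N k)] [∀ k, Module R (N k)]
  {Rk : ℕ → Type} [∀ k, CommRing (Rk k)] [∀ k, IsLocalRing (Rk k)] [∀ k, TopologicalSpace (Rk k)]
  [∀ k, DiscreteTopology (Rk k)] [∀ k, Algebra ℤ_[p] (Rk k)] [∀ k, Algebra R (Rk k)]
  [∀ k, Module (Rk k) (N k)] [∀ k, IsScalarTower R (Rk k) (N k)]
  {Nbar : Type} [AddCommGroup Nbar] [TopologicalSpace Nbar] [DiscreteTopology Nbar]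
  [∀ k, Module (Rk k) Nbar]
  {Nq : ℕ → Finset (HeightOneSpectrum (𝓞 K)) → Type} [∀ k n, AddCommGroup (Nq k n)]
  [∀ k n, TopologicalSpace (Nq k n)] [∀ k n, DiscreteTopology (Nq k n)]
  [∀ k n, Module (Rk k) (Nq k n)] [∀ k n, Module R (Nq k n)]
  [∀ k n, IsScalarTower R (Rk k) (Nq k n)]

/-- `p^j ∈ (π^j)` in `R` (`p ∈ 𝔪 = (π)`, `DVRSetting.natCast_p_mem_maximalIdeal`).
[cite: Howard2004HeegnerKolyvagin, §1.6 (arXiv p. 11 L13–14: `R` a DVR with uniformiser `π`)] -/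
theorem natCast_p_pow_mem_span_pi_pow (S : DVRSetting p K R N Rk Nbar Nq) (hy : S.SatisfiesH) (j : ℕ) :
    ((p : ℕ) : R) ^ j ∈ Ideal.span {S.π ^ j} := by
  rw [← Ideal.span_singleton_pow, ← hy.unif]
  exact Ideal.pow_mem_pow (S.natCast_p_mem_maximalIdeal hy) j

/-- **Howard's Remark 1.3.1 for H.4 on a `DVRSetting` (module part): the duality datum of every quotient
`T^{(k)}/π^j T^{(k)}`, `1 ≤ j ≤ e_k`** — on the tree's `modIdeal (S.T.ρ k) (S.T.hlin k) (π^j)` over w2 g16's level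
ring `S.QuotRing j = R/π^j` (topology `S.quotRingTopology j`), reducing `S.D k` through `S.toQuotRing hy h`:
`Dj.e [s] [t] = toQuotRing ((S.D k).e s t)`; symmetric, PERFECT (H.0: `T^{(k)}` free of rank two over `R_k`),
`Γ_K`-equivariant, `twistOne = (R/π^j)(1)`.  For `k = host j` of the `π`-adic refinement this is, definitionally, the
H.4 datum of `PiRefinementDatum.levelRep j` on `Level j` (next theorem).
[cite: Howard2004HeegnerKolyvagin, §1.3 H.4 and Rem. 1.3.1 (arXiv p. 7 L69–80, L125–127)] [cite: MazurRubinMemoirs2004, §2.1] -/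
theorem exists_dualityDatum_modIdeal (S : DVRSetting p K R N Rk Nbar Nq) (hy : S.SatisfiesH) {j k : ℕ}
    (h : j ≤ S.e k) :
    letI := S.quotRingTopology j
    haveI := S.quotRing_discreteTopology j
    ∃ Dj : DualityDatum p S.cd (modIdeal (S.T.ρ k) (S.T.hlin k) (Ideal.span {S.π ^ j})) (S.QuotRing j),
      ∀ s t : N k, Dj.e (Submodule.Quotient.mk s) (Submodule.Quotient.mk t) = S.toQuotRing hy h ((S.D k).e s t) := by
  haveI : Module.Free (Rk k) (N k) := (hy.h0 k).1
  haveI : Module.Finite (Rk k) (N k) := Module.finite_of_finrank_eq_succ (hy.h0 k).2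
  exact DualityDatum.exists_modIdeal (S.T.ρ k) (S.T.hlin k) S.cd S.π j (S.D k) (hy.algebraMap_surjective k)
    (S.toQuotRing hy h) (S.toQuotRing_algebraMap hy h) (S.toQuotRing_algebraMap_padicInt hy h) j
    (S.natCast_p_pow_mem_span_pi_pow hy j)

/-- **The same on the `π`-adic refinement datum: the H.4 datum of `Level j = T/π^jT` with its action `levelRep j`**
(`D := S.piRefinementDatum hy`, host `k := D.host j`, ring `R ⧸ (D.π^j)` = `S.QuotRing j` definitionally):
`Dj.e (proj s) (proj t) = toQuotRing ((S.D k).e s t)`.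
[cite: Howard2004HeegnerKolyvagin, §1.3 H.4 and Rem. 1.3.1 (arXiv p. 7 L69–80, L125–127)] [cite: MazurRubinMemoirs2004, §2.1] -/
theorem exists_levelDualityDatum (S : DVRSetting p K R N Rk Nbar Nq) (hy : S.SatisfiesH) (j : ℕ) :
    letI : TopologicalSpace (R ⧸ Ideal.span {(S.piRefinementDatum hy).π ^ j}) := ⊥
    haveI : DiscreteTopology (R ⧸ Ideal.span {(S.piRefinementDatum hy).π ^ j}) := ⟨rfl⟩
    ∃ Dj : DualityDatum p S.cd ((S.piRefinementDatum hy).levelRep j) (R ⧸ Ideal.span {(S.piRefinementDatum hy).π ^ j}),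
      ∀ s t : N ((S.piRefinementDatum hy).host j),
        Dj.e ((S.piRefinementDatum hy).proj le_rfl s) ((S.piRefinementDatum hy).proj le_rfl t) =
          S.toQuotRing hy ((S.piRefinementDatum hy).le_e_host j) ((S.D ((S.piRefinementDatum hy).host j)).e s t) := by
  obtain ⟨Dj, hDj⟩ := S.exists_dualityDatum_modIdeal hy ((S.piRefinementDatum hy).le_e_host j)
  refine ⟨Dj, fun s t => ?_⟩
  rw [PiRefinementDatum.proj_apply, PiRefinementDatum.proj_apply, (S.piRefinementDatum hy).red_refl,
    (S.piRefinementDatum hy).red_refl]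
  exact hDj s t

end DVRSetting

end Literature.NumberTheory.GaloisCohomology.Howard2004

end
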